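import Summits.AtomisticToContinuum.FouriersLaw.Theses.JunctionLocality
import Summits.AtomisticToContinuum.FouriersLaw.Theses.ParityLiouvilleSeed
import Summits.AtomisticToContinuum.FouriersLaw.Theses.FeketeSeriesLaw
import Summits.AtomisticToContinuum.FouriersLaw.Theorems.JunctionLocalitySuperadditiveResistanceDiagonalSplit
import Summits.AtomisticToContinuum.FouriersLaw.Theorems.JunctionLocalitySuperadditiveResistanceEvenDoublingKuboReduction

/-!
# Crux `SuperadditiveResistance` (stmt-AtomisticToContinuum-11748) — line `diagonal-split-series-law`
# (crux-strategist seat `planner-cstrat-stmt-AtomisticToContinuum-11748-s1-0`, gen 1, 2026-08-17; skeleton v1.2 — lead c19: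
#  the real-analysis glue and the Kubo form of stub 1 are now LANDED Theorems files and are imported instead of re-proved)

Crux (A), shared decl `JunctionLocality.SuperadditiveResistance = ParityLiouvilleSeed.SuperadditiveResistance`
(`Disproof.twin_eq`): along the weak-NESS shell, `∃ C ∀ N M ≥ 2, R_N + R_M − C ≤ R_{N+M}`, `R_N := (N−1)/D_N`.

THE LINE — DIAGONAL REDUCTION MODULO THE SERIES LAW.  The quantifier `∀ N M` of (A) is split into
* `stub_evenDoubling` — (A) ON THE DIAGONAL `N = M`: `∃ C₁ ∀ N ≥ 2, 2R_N − C₁ ≤ R_{2N}`, the one junction comparison in which the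
  joined `2N`-chain carries the exact ℤ₂ reflection symmetry `i ↦ 2N−1−i`, `δ ↦ −δ` (odd first-order response density, junction pair
  at relative temperature `0`).  STRICTLY WEAKER than (A): `doubling_not_sufficient` below (a positive `R` with doubling defect `≤ 0`
  violating the crux shape on lopsided splits).  It is the kill statistic of `Disproof.lean` §2 read as a target and, in the
  Peierls–Boltzmann slab caricature, `≥ Σ_{ℓ_m ≤ N} w_m ℓ_m²/(3κ²)` (`slab_doubling_defect_ge`): it carries the rate content of (A).
* `stub_quasiSubadditiveResistance` — the OTHER-SIDED series law `∃ C₂ ∀ N M ≥ 2, R_{N+M} ≤ R_N + R_M + C₂`, VERBATIM the rank-2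
  crux `FeketeSeriesLaw.QuasiSubadditiveResistance` (stmt-AtomisticToContinuum-14041; `stub_quasiSubadditiveResistance_iff` is
  `Iff.rfl`), independently staffed by route FeketeSeriesLaw and implied by `SpatialCentreManifold.AffineResistanceLaw`
  (stmt-13407, `CruxPosition.quasiSubadditiveResistance_of_affineResistanceLaw`).  NOT implied by (A) (`R_N = ℓN − b log N`) —
  the honest price of any diagonal-to-lopsided transfer ("must consume an upper bound on the resistance of a union", line card
  of `balanced-split-concavity-transfer` §Transfer); unlike that line's `BalancedMaximality` (false for admissible shapes,
  `Card4Witness.lean`) it is a true-leaning, already-filed statement.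

COMPOSITION (sorry-free, pure real analysis): `b_N := R_N + C₂` is subadditive on `{N ≥ 2}` and `R_N > 0`, so the tree's
restricted Fekete lemma (`boundedResponseConverges_tendsto_div_of_superadditive` on `−b`) gives `ℓ := lim R_N/N` and the LOWER
envelope `R_N ≥ ℓN − C₂` (`lower_envelope_of_quasiSubadditive`); with `g := R − ℓ·`, doubling reads `h_N ≤ h_{2N}/2` for
`h := g − C₁`, and `h_{2^kN}/2^k → 0` gives the UPPER envelope `R_N ≤ ℓN + C₁` (`le_of_doubling_of_tendsto_div`); hence
`R_N + R_M − R_{N+M} = g_N + g_M − g_{N+M} ≤ 2C₁ + C₂` (`insertionBounded_of_doubling_of_quasiSubadditive`).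
`SuperadditiveResistance_of` concludes the route decl BY NAME from the two stubs (hypothesis form: `superadditiveResistance_of_stubs`).  The same proof is the crux workfile `DiagonalSplit.lean`
(`superadditiveResistance_of_subs`, item evidence `Split.lean`), ready to be landed under `Theorems/` by a prover and to serve as
the `--glue` of the route-level split `SuperadditiveResistance ⇐ EvenDoubling ∧ QuasiSubadditiveResistance` (children.json in
the strategist folder; the split verb is reserved to a seat's final cycle).

Why this dodges the STUCK goals of the live line (fpbl κ-frame v9: S1''/S2''/S3''): those are N-uniform local-influence bounds at
a LOPSIDED junction of the never-cut `(N+M)`-chain, where no symmetry relates the two blocks and three legs must be paid; here the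
only junction left is the balanced one (one leg, ℤ₂-odd sector), and everything lopsided is real analysis plus a statement another
route must prove anyway.  What it does NOT dodge: `stub_evenDoubling` is still an `N`-uniform comparison (2N-chain vs two bathed
N-chains) for a deterministic anharmonic chain — no engine in tree or print (BonettoLebowitzReyBellet2000 §6.3; barrier
`Literature.Barriers.AtomisticToContinuum.FixedLengthNoConductivityControl`).

Disproof used (`Cruxes/SuperadditiveResistance/Disproof.lean`, sha 30a0c7de): `superadditiveResistance_false_without_dynamics` —
honoured: both stubs keep the full dynamical shell, and each stub's conclusion is false for a general positive `D`
(`doubling_not_sufficient`'s `R` has defect `≤ 0` but e.g. `R_N = N²` violates the series law and `R_N = N` odd/`3N` even … see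
below), so the dynamics is used AT BOTH STUBS; `InsertionBounded.doubling` — `stub_evenDoubling` is exactly its conclusion under the
shell (necessary for (A): `evenDoubling_of_crux`); kill profiles `not_insertionBounded_of_log_correction` /
`_of_rpow_correction` violate `stub_evenDoubling` (rate content sits there), `insertionBounded_of_subadditive_dip` profiles
violate `stub_quasiSubadditiveResistance` only when the dip is NOT O(1) — the line over-claims exactly the two-sided law
(A) ∧ QS = `BoundedAffineDeviation` (StrategyCensus.lean S⁺₂), flagged not hidden; `harmonic_corner_constant_ge_ballistic_resistance`
— consistent (`C₁ ≥ 1/fluxLimit` forced inside `stub_evenDoubling`; all constants parameter-dependent).  Landed Negative lemmas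
(`Theorems/SuperadditiveResistance/Negative/{KillCriteria,HarmonicCornerTightness}`): none instantiated by either stub (both `∃ C`).
-/

namespace Summit.AtomisticToContinuum.FouriersLaw.Cruxes.SuperadditiveResistance.DiagonalSplitSeriesLaw

open Filter Topology
open Summit.AtomisticToContinuum.FouriersLaw.Theorems (boundedResponseConverges_tendsto_div_of_superadditive)

/-! ## §1 Registered stubs -/

/-- **Stub 1 — `EvenDoubling` (bounded doubling defect; the crux on the diagonal; XL, load-bearing).**  Over the crux's
own shell: `∃ C ∀ N ≥ 2, 2R_N − C ≤ R_{2N}`, `R_N := (N−1)/D_N`.  Necessary for (A) (`evenDoubling_of_crux`), not sufficient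
(`doubling_not_sufficient`); with stub 2 it gives (A) (`SuperadditiveResistance_of`).  Leans on: nothing landed (N-uniform). -/
theorem stub_evenDoubling :
    ∀ ω₂ lam β γ : ℝ, 0 < ω₂ → 0 < lam → 0 < β → 0 < γ → (∀ (N : ℕ) (T_L T_R : ℝ), 0 < T_L → 0 < T_R → ∀ μ ν : MeasureTheory.Measure (Literature.MathematicalPhysics.KineticTheory.HeatConduction.PhaseSpace N), (Literature.MathematicalPhysics.KineticTheory.HeatConduction.pinnedChain ω₂ lam β γ).IsSteadyState N T_L T_R μ → (Literature.MathematicalPhysics.KineticTheory.HeatConduction.pinnedChain ω₂ lam β γ).IsSteadyState N T_L T_R ν → μ = ν) → ∀ μ : (N : ℕ) → ℝ → ℝ → MeasureTheory.Measure (Literature.MathematicalPhysics.KineticTheory.HeatConduction.PhaseSpace N), (∀ (N : ℕ) (T_L T_R : ℝ), 0 < T_L → 0 < T_R → (Literature.MathematicalPhysics.KineticTheory.HeatConduction.pinnedChain ω₂ lam β γ).IsSteadyState N T_L T_R (μ N T_L T_R)) → ∀ T : ℝ, 0 < T → ∀ D : ℕ → ℝ, (∀ N : ℕ, Filter.Tendsto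 (fun δ : ℝ => (Literature.MathematicalPhysics.KineticTheory.HeatConduction.pinnedChain ω₂ lam β γ).totalCurrent (μ N (T + δ / 2) (T - δ / 2)) / δ) (nhdsWithin 0 {(0 : ℝ)}ᶜ) (nhds (D N))) → (∀ N : ℕ, 2 ≤ N → 0 < D N) → ∃ C : ℝ, ∀ N : ℕ, 2 ≤ N → 2 * (((N : ℝ) - 1) / D N) - C ≤ ((N : ℝ) + (N : ℝ) - 1) / D (N + N) := by
  sorry

/-- **Stub 2 — `QuasiSubadditiveResistance` (series law with bounded junction defect; XL, shared).**  VERBATIM the crux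
`FeketeSeriesLaw.QuasiSubadditiveResistance` (stmt-AtomisticToContinuum-14041; `stub_quasiSubadditiveResistance_iff`): over the
same shell (no positivity hypothesis), `∃ C ∀ N M ≥ 2, R_{N+M} ≤ R_N + R_M + C`.  Closed the moment stmt-14041 (or stmt-13407
via `CruxPosition.quasiSubadditiveResistance_of_affineResistanceLaw`) lands.  Leans on: nothing landed (N-uniform). -/
theorem stub_quasiSubadditiveResistance :
    ∀ ω₂ lam β γ : ℝ, 0 < ω₂ → 0 < lam → 0 < β → 0 < γ → (∀ (N : ℕ) (T_L T_R : ℝ), 0 < T_L → 0 < T_R → ∀ μ ν : MeasureTheory.Measure (Literature.MathematicalPhysics.KineticTheory.HeatConduction.PhaseSpace N), (Literature.MathematicalPhysics.KineticTheory.HeatConduction.pinnedChain ω₂ lam β γ).IsSteadyState N T_L T_R μ → (Literature.MathematicalPhysics.KineticTheory.HeatConduction.pinnedChain ω₂ lam β γ).IsSteadyState N T_L T_R ν → μ = ν) → ∀ μ : (N : ℕ) → ℝ → ℝ → MeasureTheory.Measure (Literature.MathematicalPhysics.KineticTheory.HeatConduction.PhaseSpace N), (∀ (N : ℕ) (T_L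 T_R : ℝ), 0 < T_L → 0 < T_R → (Literature.MathematicalPhysics.KineticTheory.HeatConduction.pinnedChain ω₂ lam β γ).IsSteadyState N T_L T_R (μ N T_L T_R)) → ∀ T : ℝ, 0 < T → ∀ D : ℕ → ℝ, (∀ N : ℕ, Filter.Tendsto (fun δ : ℝ => (Literature.MathematicalPhysics.KineticTheory.HeatConduction.pinnedChain ω₂ lam β γ).totalCurrent (μ N (T + δ / 2) (T - δ / 2)) / δ) (nhdsWithin 0 {(0 : ℝ)}ᶜ) (nhds (D N))) → ∃ C : ℝ, ∀ N M : ℕ, 2 ≤ N → 2 ≤ M → ((N + M - 1 : ℕ) : ℝ) / D (N + M) ≤ ((N - 1 : ℕ) : ℝ) / D N + ((M - 1 : ℕ) : ℝ) / D M + C := by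
  sorry

/-- Stub 2 is literally route FeketeSeriesLaw's crux (definitional). [folklore] -/
theorem stub_quasiSubadditiveResistance_iff :
    (∀ ω₂ lam β γ : ℝ, 0 < ω₂ → 0 < lam → 0 < β → 0 < γ → (∀ (N : ℕ) (T_L T_R : ℝ), 0 < T_L → 0 < T_R → ∀ μ ν : MeasureTheory.Measure (Literature.MathematicalPhysics.KineticTheory.HeatConduction.PhaseSpace N), (Literature.MathematicalPhysics.KineticTheory.HeatConduction.pinnedChain ω₂ lam β γ).IsSteadyState N T_L T_R μ → (Literature.MathematicalPhysics.KineticTheory.HeatConduction.pinnedChain ω₂ lam β γ).IsSteadyState N T_L T_R ν → μ = ν) → ∀ μ : (N : ℕ) → ℝ → ℝ → MeasureTheory.Measure (Literature.MathematicalPhysics.KineticTheory.HeatConduction.PhaseSpace N), (∀ (N : ℕ) (T_L T_R : ℝ), 0 < T_L → 0 < T_R → (Literature.MathematicalPhysics.KineticTheory.HeatConduction.pinnedChain ω₂ lam β γ).IsSteadyState N T_L T_R (μ N T_L T_R)) → ∀ T : ℝ, 0 < T → ∀ D : ℕ → ℝ, (∀ N : ℕ, Filter.Tendsto (fun δ :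 ℝ => (Literature.MathematicalPhysics.KineticTheory.HeatConduction.pinnedChain ω₂ lam β γ).totalCurrent (μ N (T + δ / 2) (T - δ / 2)) / δ) (nhdsWithin 0 {(0 : ℝ)}ᶜ) (nhds (D N))) → ∃ C : ℝ, ∀ N M : ℕ, 2 ≤ N → 2 ≤ M → ((N + M - 1 : ℕ) : ℝ) / D (N + M) ≤ ((N - 1 : ℕ) : ℝ) / D N + ((M - 1 : ℕ) : ℝ) / D M + C) ↔
      Summit.AtomisticToContinuum.FouriersLaw.Theses.FeketeSeriesLaw.QuasiSubadditiveResistance :=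
  Iff.rfl

/-! ## §2 Composition BY NAME (glue landed: `Theorems/JunctionLocalitySuperadditiveResistanceDiagonalSplit.lean`) -/

open Summit.AtomisticToContinuum.FouriersLaw.Theorems.SuperadditiveResistance.DiagonalSplit
  (superadditiveResistance_of_subs' evenDoubling_of_superadditiveResistance)

/-- **Skeleton composition (the crux BY NAME from the two registered stubs; `sorry` only inside the stubs).**
The landed glue `DiagonalSplit.superadditiveResistance_of_subs'` (Fekete lower envelope from stub 2 + dyadic upper envelope
from stub 1 ⇒ insertion defect `≤ 2C₁ + C₂`) applied to `stub_evenDoubling` and `stub_quasiSubadditiveResistance`. [folklore] -/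
theorem SuperadditiveResistance_of :
    Summit.AtomisticToContinuum.FouriersLaw.Theses.JunctionLocality.SuperadditiveResistance :=
  superadditiveResistance_of_subs' stub_evenDoubling stub_quasiSubadditiveResistance

/-- **Stub 1 is NECESSARY** (landed: `DiagonalSplit.evenDoubling_of_superadditiveResistance`): the crux contains its
diagonal. Its hypothesis-free equilibrium form is landed too (`evenDoubling_iff_kuboDoublingBound`,
`Theorems/JunctionLocalitySuperadditiveResistanceEvenDoublingKuboReduction.lean`): `∃ C ∀ N ≥ 2 ∀ g_N g_{2N}, 2/G_N − C ≤ 1/G_{2N}`. [folklore] -/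
theorem evenDoubling_of_crux
    (hA : Summit.AtomisticToContinuum.FouriersLaw.Theses.JunctionLocality.SuperadditiveResistance) :
    ∀ ω₂ lam β γ : ℝ, 0 < ω₂ → 0 < lam → 0 < β → 0 < γ → (∀ (N : ℕ) (T_L T_R : ℝ), 0 < T_L → 0 < T_R → ∀ μ ν : MeasureTheory.Measure (Literature.MathematicalPhysics.KineticTheory.HeatConduction.PhaseSpace N), (Literature.MathematicalPhysics.KineticTheory.HeatConduction.pinnedChain ω₂ lam β γ).IsSteadyState N T_L T_R μ → (Literature.MathematicalPhysics.KineticTheory.HeatConduction.pinnedChain ω₂ lam β γ).IsSteadyState N T_L T_R ν → μ = ν) → ∀ μ : (N : ℕ) → ℝ → ℝ → MeasureTheory.Measure (Literature.MathematicalPhysics.KineticTheory.HeatConduction.PhaseSpace N), (∀ (N : ℕ) (T_L T_R : ℝ), 0 < T_L → 0 < T_R → (Literature.MathematicalPhysics.KineticTheory.HeatConduction.pinnedChain ω₂ lam β γ).IsSteadyState N T_L T_R (μ N T_L T_R)) → ∀ T : ℝ, 0 < T → ∀ D : ℕ → ℝ, (∀ N : ℕ, Filter.Tendsto (fun δ :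 ℝ => (Literature.MathematicalPhysics.KineticTheory.HeatConduction.pinnedChain ω₂ lam β γ).totalCurrent (μ N (T + δ / 2) (T - δ / 2)) / δ) (nhdsWithin 0 {(0 : ℝ)}ᶜ) (nhds (D N))) → (∀ N : ℕ, 2 ≤ N → 0 < D N) → ∃ C : ℝ, ∀ N : ℕ, 2 ≤ N → 2 * (((N : ℝ) - 1) / D N) - C ≤ ((N : ℝ) + (N : ℝ) - 1) / D (N + N) :=
  evenDoubling_of_superadditiveResistance hA

end Summit.AtomisticToContinuum.FouriersLaw.Cruxes.SuperadditiveResistance.DiagonalSplitSeriesLaw
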